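import Mathlib
import HarnessLib
import Literature.Analysis.PDE.DivFormStrongMaximumPrinciple
import Summits.NavierStokesRegularity.NavierStokesRegularity.Theorems.PoloidalWindowDoorPoloidalWindowRigidityDivFormCaccioppoli
import Summits.NavierStokesRegularity.NavierStokesRegularity.Theorems.PoloidalWindowDoorPoloidalWindowRigidityDivFormDescent
import Summits.NavierStokesRegularity.NavierStokesRegularity.Theorems.PoloidalWindowDoorPoloidalWindowRigidityDivFormStrongMaximumPrincipleGlobalise

/-!
# Route `PoloidalWindowDoor`, crux K2 (stmt-NavierStokesRegularity-19708) — DESCENT `n + 1 ⇒ n` of the strong maximum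
# principle for `div(a∇u) = 0` (towards `divFormStrongMaximumPrinciple_holds`, Gilbarg–Trudinger Thm 8.19)

`P n` denotes the body of the named fact `Literature.Analysis.PDE.divFormStrongMaximumPrinciple` at a FIXED dimension
`n` (spelled out binder for binder, no new definition): on an open preconnected `Ω ⊆ ℝⁿ`, for symmetric
`λ`-elliptic `Λ`-bounded measurable coefficients on `Ω` and `u ∈ C¹(Ω)` a weak solution against tests with
`tsupport η ⊆ Ω`, an interior maximum point `x₀` forces `u ≡ u x₀` on `Ω`.  This file proves
`smp_descent : P (n + 1) → P n` — the local analogue of `…DivFormLiouvilleAll.liouville_descent`: the solution `u` on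
`Ω` lifts to `ũ = u ∘ π` on the tube `Ω̃ = π⁻¹(Ω)` (`π` = forget the last coordinate, `…DivFormDescent.proj`), which is
open and preconnected (the image of `Ω × ℝ` under `(x, t) ↦ ιx + t e_last`), `ũ ∈ C¹(Ω̃)` solves `div(ã∇ũ) = 0`
weakly in `Ω̃` for the lifted coefficients `ã = (a ∘ π) ⊕ 1` (`liftCoeff`, after the coefficients have been made
global by `…Globalise.exists_global_coeff`), and attains its maximum over `Ω̃` at `ι x₀`; so `P (n + 1)` gives
`ũ ≡ ũ(ι x₀)` on `Ω̃`, i.e. `u ≡ u x₀` on `Ω`.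

* `isPreconnected_preimage_proj` — the tube over a preconnected set is preconnected;
* `lift_integrand_eq_of_differentiableAt` — the lifted weak-form integrand at `z` equals the `n`-dimensional one for the
  slice test `η_{z_last}` at `πz` (the tree's `lift_integrand_eq` with `DifferentiableAt` in place of `ContDiff`);
* `lift_weak_local` — the Fubini step of `…DivFormLiouvilleAll.lift_weak` for a LOCAL solution `u ∈ C¹(Ω)` and tests
  with `tsupport η̃ ⊆ Ω̃` (whose slices have `tsupport ⊆ Ω`); integrability now comes from the boundedness of `Dũ`
  on the compact `tsupport η̃ ⊆ Ω̃` instead of global continuity;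
* `smp_descent` — `P (n + 1) → P n`.

Seat ns-in-ser-a g7 (cell pub/ns-inputs), width piece W3 of ns-in-ser-b g5's programme for
`divFormStrongMaximumPrinciple_holds` (interfaces fixed on pub/ns-inputs/STATUS 2026-08-28T18:22:32Z).  Adapted from
`…DivFormLiouvilleAll` (seat ns-poloidal-K2-p3; Fubini bookkeeping copied, hypotheses localised).

WHAT THIS IS NOT: not the strong maximum principle itself in any dimension (ser-b's local Harnack files give `P n` for
`n ≥ 3`; this file only transports it downwards); nothing here is specific to Navier–Stokes and no NS statement is
touched.
-/

noncomputable section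

open MeasureTheory Set Function Filter Topology Metric Module
open scoped Matrix ENNReal NNReal

-- the summit and its single sub-problem share the name (CONVENTIONS §1), as in every Theorems file
set_option linter.dupNamespace false

namespace Summit.NavierStokesRegularity.NavierStokesRegularity.Theorems.PoloidalWindowDoorPoloidalWindowRigidityDivFormStrongMaximumPrincipleDescent

open Summit.NavierStokesRegularity.NavierStokesRegularity.Theorems.PoloidalWindowDoorPoloidalWindowRigidityDivFormCaccioppoli
open Summit.NavierStokesRegularity.NavierStokesRegularity.Theorems.PoloidalWindowDoorPoloidalWindowRigidityDivFormDescent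
open Summit.NavierStokesRegularity.NavierStokesRegularity.Theorems.PoloidalWindowDoorPoloidalWindowRigidityDivFormStrongMaximumPrincipleGlobalise

variable {n : ℕ}

/-! ### The tube over a preconnected set -/

/-- **The tube `π⁻¹(Ω)` over a preconnected `Ω ⊆ ℝⁿ` is preconnected**: it is the image of `Ω × ℝ` under the
continuous map `(x, t) ↦ ιx + t e_last`. -/
theorem isPreconnected_preimage_proj {Ω : Set (EuclideanSpace ℝ (Fin n))} (hΩ : IsPreconnected Ω) :
    IsPreconnected (proj n ⁻¹' Ω) := by
  have hg : Continuous fun p : EuclideanSpace ℝ (Fin n) × ℝ =>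
      emb n p.1 + p.2 • EuclideanSpace.single (Fin.last n) (1 : ℝ) :=
    ((emb n).continuous.comp continuous_fst).add (continuous_snd.smul continuous_const)
  have himage : (fun p : EuclideanSpace ℝ (Fin n) × ℝ =>
      emb n p.1 + p.2 • EuclideanSpace.single (Fin.last n) (1 : ℝ)) '' (Ω ×ˢ univ) = proj n ⁻¹' Ω := by
    ext z
    constructor
    · rintro ⟨⟨x, t⟩, ⟨hx, -⟩, rfl⟩
      simpa [proj_slice] using hx
    · intro hz
      exact ⟨(proj n z, z (Fin.last n)), ⟨hz, mem_univ _⟩, emb_proj_add z⟩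
  rw [← himage]
  exact (hΩ.prod isPreconnected_univ).image _ hg.continuousOn

/-! ### The lifted weak-form integrand, local version -/

variable {a : EuclideanSpace ℝ (Fin n) → Matrix (Fin n) (Fin n) ℝ} {Λ : ℝ} {u : EuclideanSpace ℝ (Fin n) → ℝ}

/-- Partial derivatives of `ũ = u ∘ π` at a point where `u` is differentiable: `Dũ(z)[v] = Du(πz)[πv]`. -/
theorem fderiv_lift_of_differentiableAt {z : EuclideanSpace ℝ (Fin (n + 1))} (hu : DifferentiableAt ℝ u (proj n z))
    (v : EuclideanSpace ℝ (Fin (n + 1))) :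
    fderiv ℝ (fun z => u (proj n z)) z v = fderiv ℝ u (proj n z) (proj n v) := by
  have h := hu.hasFDerivAt.comp z (proj n).hasFDerivAt
  rw [show (fun z => u (proj n z)) = u ∘ proj n from rfl, h.fderiv]
  rfl

/-- **The lifted weak-form integrand equals the `n`-dimensional one on the slice through `z`** — the tree's
`lift_integrand_eq` with `u` only differentiable at `πz`. -/
theorem lift_integrand_eq_of_differentiableAt {z : EuclideanSpace ℝ (Fin (n + 1))}
    (hu : DifferentiableAt ℝ u (proj n z)) {η : EuclideanSpace ℝ (Fin (n + 1)) → ℝ} (hη : ContDiff ℝ 1 η) :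
    ∑ I, ∑ J, liftCoeff a z I J * fderiv ℝ (fun z => u (proj n z)) z (EuclideanSpace.single I 1) *
        fderiv ℝ η z (EuclideanSpace.single J 1) =
      ∑ i, ∑ j, a (proj n z) i j * fderiv ℝ u (proj n z) (EuclideanSpace.single i 1) *
        fderiv ℝ (fun x => η (emb n x + z (Fin.last n) • EuclideanSpace.single (Fin.last n) (1 : ℝ))) (proj n z)
          (EuclideanSpace.single j 1) := by
  simp only [fderiv_lift_of_differentiableAt hu, fderiv_slice hη, emb_proj_add, Fin.sum_univ_castSucc,
    proj_single_castSucc, proj_single_last, map_zero, liftCoeff_castSucc_castSucc, liftCoeff_castSucc_last,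
    liftCoeff_last_castSucc, liftCoeff_last_last, zero_mul, mul_zero, add_zero, Finset.sum_const_zero]

/-- The slices `η_t = η̃(ι · + t e_last)` of a test `η̃` with `tsupport η̃ ⊆ π⁻¹(Ω)` have `tsupport η_t ⊆ Ω`. -/
theorem tsupport_slice_subset {Ω : Set (EuclideanSpace ℝ (Fin n))} {η : EuclideanSpace ℝ (Fin (n + 1)) → ℝ}
    (hηΩ : tsupport η ⊆ proj n ⁻¹' Ω) (t : ℝ) :
    tsupport (fun x => η (emb n x + t • EuclideanSpace.single (Fin.last n) (1 : ℝ))) ⊆ Ω := by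
  intro x hx
  have hcont : Continuous fun x : EuclideanSpace ℝ (Fin n) =>
      emb n x + t • EuclideanSpace.single (Fin.last n) (1 : ℝ) := (emb n).continuous.add continuous_const
  have h1 : tsupport (fun x => η (emb n x + t • EuclideanSpace.single (Fin.last n) (1 : ℝ))) ⊆
      (fun x => emb n x + t • EuclideanSpace.single (Fin.last n) (1 : ℝ)) ⁻¹' tsupport η :=
    closure_minimal (fun y hy => subset_closure hy) ((isClosed_tsupport η).preimage hcont)
  have h2 := hηΩ (h1 hx)
  simpa [proj_slice] using h2

/-- **The lift `ũ = u ∘ π` of a LOCAL weak solution is a weak solution for `ã` in the tube.**  Let `u ∈ C¹(Ω)` (`Ω`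
open) solve `∫ Σᵢⱼ aᵢⱼ ∂ᵢu ∂ⱼη = 0` for all `η ∈ C¹_c` with `tsupport η ⊆ Ω`, where `a` has measurable entries with
`|aᵢⱼ| ≤ Λ` everywhere.  Then `∫ Σ_IJ ã_IJ ∂_I ũ ∂_J η̃ = 0` for every `η̃ ∈ C¹_c(ℝⁿ⁺¹)` with `tsupport η̃ ⊆ π⁻¹(Ω)`
(Fubini over the last coordinate; each slice `η̃_t` is an admissible `n`-dimensional test). -/
theorem lift_weak_local {Ω : Set (EuclideanSpace ℝ (Fin n))} (hΩ : IsOpen Ω)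
    (hmeas : ∀ i j, Measurable fun y => a y i j) (hbd : ∀ y i j, |a y i j| ≤ Λ) (hu : ContDiffOn ℝ 1 u Ω)
    (hweak : ∀ η : EuclideanSpace ℝ (Fin n) → ℝ, ContDiff ℝ 1 η → HasCompactSupport η → tsupport η ⊆ Ω →
      ∫ y, ∑ i, ∑ j, a y i j * fderiv ℝ u y (EuclideanSpace.single i 1) *
        fderiv ℝ η y (EuclideanSpace.single j 1) = 0)
    (η : EuclideanSpace ℝ (Fin (n + 1)) → ℝ) (hη : ContDiff ℝ 1 η) (hηc : HasCompactSupport η)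
    (hηΩ : tsupport η ⊆ proj n ⁻¹' Ω) :
    ∫ z, ∑ I, ∑ J, liftCoeff a z I J * fderiv ℝ (fun z => u (proj n z)) z (EuclideanSpace.single I 1) *
      fderiv ℝ η z (EuclideanSpace.single J 1) = 0 := by
  -- the slice integrand `G0 t x = Σ aᵢⱼ(x) ∂ᵢu(x) ∂ⱼη_t(x)`
  obtain ⟨G0, hG0⟩ : ∃ G0 : ℝ → EuclideanSpace ℝ (Fin n) → ℝ, ∀ t x, G0 t x = ∑ i, ∑ j, a x i j *
      fderiv ℝ u x (EuclideanSpace.single i 1) *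
        fderiv ℝ (fun x => η (emb n x + t • EuclideanSpace.single (Fin.last n) (1 : ℝ))) x
          (EuclideanSpace.single j 1) := ⟨_, fun _ _ => rfl⟩
  have hslice0 : ∀ t, ∫ x, G0 t x = 0 := fun t => by
    simp only [hG0]
    exact hweak _ (contDiff_slice hη t) (hasCompactSupport_slice hηc t) (tsupport_slice_subset hηΩ t)
  -- the tube is open and `ũ ∈ C¹` on it
  have hΩt : IsOpen (proj n ⁻¹' Ω) := hΩ.preimage (proj n).continuous
  have hut : ContDiffOn ℝ 1 (fun z => u (proj n z)) (proj n ⁻¹' Ω) :=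
    hu.comp (proj n).contDiff.contDiffOn (fun z hz => hz)
  -- rewrite the lifted integrand as `G0 (z_last) (π z)`
  have hpt : ∀ z, ∑ I, ∑ J, liftCoeff a z I J * fderiv ℝ (fun z => u (proj n z)) z (EuclideanSpace.single I 1) *
      fderiv ℝ η z (EuclideanSpace.single J 1) = G0 (z (Fin.last n)) (proj n z) := by
    intro z
    rw [hG0]
    by_cases hz : z ∈ proj n ⁻¹' Ω
    · exact lift_integrand_eq_of_differentiableAt
        (((hu.differentiableOn one_ne_zero) (proj n z) hz).differentiableAt (hΩ.mem_nhds hz)) hη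
    · have hz' : z ∉ tsupport η := fun h => hz (hηΩ h)
      have h0 : fderiv ℝ η z = 0 := fderiv_of_notMem_tsupport ℝ hz'
      simp [fderiv_slice hη, emb_proj_add, h0]
  simp_rw [hpt]
  -- integrability of `z ↦ G0 (z_last) (πz)` on `ℝⁿ⁺¹`: undo the rewrite; `Dũ` is bounded on `tsupport η̃`
  have hInt : Integrable fun z : EuclideanSpace ℝ (Fin (n + 1)) => G0 (z (Fin.last n)) (proj n z) := by
    have heq : (fun z : EuclideanSpace ℝ (Fin (n + 1)) => G0 (z (Fin.last n)) (proj n z)) = fun z =>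
        ∑ I, ∑ J, liftCoeff a z I J * fderiv ℝ (fun z => u (proj n z)) z (EuclideanSpace.single I 1) *
          fderiv ℝ η z (EuclideanSpace.single J 1) := by
      funext z; rw [hpt z]
    rw [heq]
    -- a bound for `Dũ` on the compact `tsupport η̃ ⊆ π⁻¹(Ω)`
    have hcontOn : ContinuousOn (fderiv ℝ (fun z => u (proj n z))) (tsupport η) :=
      (hut.continuousOn_fderiv_of_isOpen hΩt le_rfl).mono hηΩ
    obtain ⟨C, hC⟩ := IsCompact.exists_bound_of_continuousOn hηc hcontOn
    refine integrable_finsetSum _ fun I _ => integrable_finsetSum _ fun J _ => ?_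
    set m : EuclideanSpace ℝ (Fin (n + 1)) → ℝ := (tsupport η).indicator fun z =>
      liftCoeff a z I J * fderiv ℝ (fun z => u (proj n z)) z (EuclideanSpace.single I 1) with hm
    have hmmeas : Measurable m :=
      (((measurable_liftCoeff hmeas I J).mul
        (measurable_fderiv_apply_const ℝ (fun z => u (proj n z)) (EuclideanSpace.single I 1))).indicator
        (isClosed_tsupport η).measurableSet)
    have hmle : ∀ z, |m z| ≤ max Λ 1 * (max C 0 * ‖(EuclideanSpace.single I (1 : ℝ) :
        EuclideanSpace ℝ (Fin (n + 1)))‖) := by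
      intro z
      by_cases hz : z ∈ tsupport η
      · rw [hm, indicator_of_mem hz, abs_mul]
        refine mul_le_mul (abs_liftCoeff_le hbd z I J) ?_ (abs_nonneg _) (le_trans (abs_nonneg _)
          (abs_liftCoeff_le hbd z I J))
        calc |fderiv ℝ (fun z => u (proj n z)) z (EuclideanSpace.single I 1)|
            ≤ ‖fderiv ℝ (fun z => u (proj n z)) z‖ * ‖(EuclideanSpace.single I (1 : ℝ) :
                EuclideanSpace ℝ (Fin (n + 1)))‖ := by
              rw [← Real.norm_eq_abs]; exact ContinuousLinearMap.le_opNorm _ _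
          _ ≤ max C 0 * ‖(EuclideanSpace.single I (1 : ℝ) : EuclideanSpace ℝ (Fin (n + 1)))‖ :=
              mul_le_mul_of_nonneg_right ((hC z hz).trans (le_max_left _ _)) (norm_nonneg _)
      · rw [hm, indicator_of_notMem hz, abs_zero]; positivity
    have hcη := continuous_fderiv_single hη J
    have hφc : HasCompactSupport fun z => fderiv ℝ η z (EuclideanSpace.single J 1) := by
      have h0 : HasCompactSupport (fderiv ℝ η) := hηc.fderiv (𝕜 := ℝ)
      exact h0.mono (Function.support_subset_iff'.2 fun z hz => by
        simp only [Function.mem_support, not_not] at hz; simp [hz])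
    have h := integrable_mul_of_le_continuous (n := n + 1) hmmeas continuous_const hmle hcη hφc
    refine h.congr (Eventually.of_forall fun z => ?_)
    by_cases hz : z ∈ tsupport η
    · simp only [hm, indicator_of_mem hz]
    · have h0 : fderiv ℝ η z = 0 := fderiv_of_notMem_tsupport ℝ hz
      simp [hm, indicator_of_notMem hz, h0]
  -- (1) to `Fin (n+1) → ℝ`
  set g : (Fin (n + 1) → ℝ) → ℝ := fun f => G0 (f (Fin.last n)) (WithLp.toLp 2 fun j => f (Fin.castSucc j)) with hg
  have hproj : ∀ z : EuclideanSpace ℝ (Fin (n + 1)), proj n z = WithLp.toLp 2 (fun j => z (Fin.castSucc j)) := fun z =>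
    PiLp.ext fun j => by simp
  have hGg : (fun z : EuclideanSpace ℝ (Fin (n + 1)) => G0 (z (Fin.last n)) (proj n z)) = g ∘ WithLp.ofLp := by
    funext z; simp only [Function.comp_apply, hg, hproj]
  have hmp1 : MeasurePreserving (MeasurableEquiv.toLp 2 (Fin (n + 1) → ℝ)).symm := by
    simpa [MeasurableEquiv.coe_toLp_symm] using PiLp.volume_preserving_ofLp (Fin (n + 1))
  have h1 : ∫ z : EuclideanSpace ℝ (Fin (n + 1)), G0 (z (Fin.last n)) (proj n z) = ∫ f : Fin (n + 1) → ℝ, g f := by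
    rw [hGg]
    exact hmp1.integral_comp' g
  have hIg : Integrable g := by
    have h := (hmp1.integrable_comp_emb (MeasurableEquiv.toLp 2 (Fin (n + 1) → ℝ)).symm.measurableEmbedding (g := g)).1
    apply h
    rw [MeasurableEquiv.coe_toLp_symm, ← hGg]
    exact hInt
  -- (2) split the last coordinate
  set e := MeasurableEquiv.piFinSuccAbove (fun _ : Fin (n + 1) => ℝ) (Fin.last n) with he
  have hmp2 : MeasurePreserving e.symm :=
    (volume_preserving_piFinSuccAbove (fun _ : Fin (n + 1) => ℝ) (Fin.last n)).symm _
  have hge : ∀ p : ℝ × (Fin n → ℝ), g (e.symm p) = G0 p.1 (WithLp.toLp 2 p.2) := by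
    rintro ⟨t, x⟩
    simp only [hg, he, MeasurableEquiv.piFinSuccAbove, MeasurableEquiv.symm_mk, MeasurableEquiv.coe_mk,
      Equiv.symm_symm, Fin.insertNthEquiv, Equiv.coe_fn_mk, Fin.insertNth_last', Fin.snoc_last]
    congr 2
    funext j
    rw [Fin.snoc_castSucc]
  have h2 : ∫ f : Fin (n + 1) → ℝ, g f = ∫ p : ℝ × (Fin n → ℝ), G0 p.1 (WithLp.toLp 2 p.2) := by
    rw [← hmp2.integral_comp' g]
    exact integral_congr_ae (Eventually.of_forall hge)
  have hIp : Integrable fun p : ℝ × (Fin n → ℝ) => G0 p.1 (WithLp.toLp 2 p.2) := by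
    have h := (hmp2.integrable_comp_emb e.symm.measurableEmbedding (g := g)).2 hIg
    exact h.congr (Eventually.of_forall hge)
  -- (3) Fubini and the slices
  have hmp3 : MeasurePreserving (MeasurableEquiv.toLp 2 (Fin n → ℝ)) := by
    simpa [MeasurableEquiv.coe_toLp] using PiLp.volume_preserving_toLp (Fin n)
  have h3 : ∫ p : ℝ × (Fin n → ℝ), G0 p.1 (WithLp.toLp 2 p.2) = ∫ t : ℝ, ∫ x : Fin n → ℝ, G0 t (WithLp.toLp 2 x) := by
    rw [← integral_prod _ hIp]; rfl
  have h4 : ∀ t : ℝ, ∫ x : Fin n → ℝ, G0 t (WithLp.toLp 2 x) = 0 := by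
    intro t
    have h := hmp3.integral_comp' (G0 t)
    rw [MeasurableEquiv.coe_toLp] at h
    rw [h]
    exact hslice0 t
  rw [h1, h2, h3]
  simp_rw [h4]
  simp

/-! ### Descent of the strong maximum principle -/

/-- **DESCENT `P (n + 1) → P n` for the strong maximum principle** (Gilbarg–Trudinger Thm 8.19 rendering = the body of
`Literature.Analysis.PDE.divFormStrongMaximumPrinciple` at a fixed dimension): if the strong maximum principle holds
for local `C¹` weak solutions of symmetric uniformly elliptic bounded measurable divergence-form equations on open
preconnected subsets of `ℝⁿ⁺¹`, it holds on open preconnected subsets of `ℝⁿ` — apply it on the tube `π⁻¹(Ω)` to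
`ũ = u ∘ π` and the lifted coefficients `(aG ∘ π) ⊕ 1` (`aG` = `a` made global off `Ω`), whose maximum over the
tube is attained at `ι x₀`. -/
theorem smp_descent
    (hP : ∀ (Ω : Set (EuclideanSpace ℝ (Fin (n + 1)))), IsOpen Ω → IsPreconnected Ω →
      ∀ (a : EuclideanSpace ℝ (Fin (n + 1)) → Matrix (Fin (n + 1)) (Fin (n + 1)) ℝ) (lam Λ : ℝ), 0 < lam →
      (∀ i j, Measurable fun y => a y i j) → (∀ y ∈ Ω, (a y).IsSymm) →
      (∀ y ∈ Ω, ∀ ξ : Fin (n + 1) → ℝ, lam * (ξ ⬝ᵥ ξ) ≤ ξ ⬝ᵥ (a y *ᵥ ξ)) →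
      (∀ y ∈ Ω, ∀ i j, |a y i j| ≤ Λ) →
      ∀ (u : EuclideanSpace ℝ (Fin (n + 1)) → ℝ), ContDiffOn ℝ 1 u Ω →
        (∀ η : EuclideanSpace ℝ (Fin (n + 1)) → ℝ, ContDiff ℝ 1 η → HasCompactSupport η → tsupport η ⊆ Ω →
          ∫ y, ∑ i, ∑ j, a y i j * fderiv ℝ u y (EuclideanSpace.single i 1) *
            fderiv ℝ η y (EuclideanSpace.single j 1) = 0) →
        ∀ x₀ ∈ Ω, (∀ y ∈ Ω, u y ≤ u x₀) → ∀ y ∈ Ω, u y = u x₀)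
    (Ω : Set (EuclideanSpace ℝ (Fin n))) (hΩ : IsOpen Ω) (hΩc : IsPreconnected Ω)
    (a : EuclideanSpace ℝ (Fin n) → Matrix (Fin n) (Fin n) ℝ) (lam Λ : ℝ) (hlam : 0 < lam)
    (hmeas : ∀ i j, Measurable fun y => a y i j) (hsymm : ∀ y ∈ Ω, (a y).IsSymm)
    (hell : ∀ y ∈ Ω, ∀ ξ : Fin n → ℝ, lam * (ξ ⬝ᵥ ξ) ≤ ξ ⬝ᵥ (a y *ᵥ ξ))
    (hbd : ∀ y ∈ Ω, ∀ i j, |a y i j| ≤ Λ)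
    (u : EuclideanSpace ℝ (Fin n) → ℝ) (hu : ContDiffOn ℝ 1 u Ω)
    (hweak : ∀ η : EuclideanSpace ℝ (Fin n) → ℝ, ContDiff ℝ 1 η → HasCompactSupport η → tsupport η ⊆ Ω →
      ∫ y, ∑ i, ∑ j, a y i j * fderiv ℝ u y (EuclideanSpace.single i 1) *
        fderiv ℝ η y (EuclideanSpace.single j 1) = 0)
    (x₀ : EuclideanSpace ℝ (Fin n)) (hx₀ : x₀ ∈ Ω) (hmax : ∀ y ∈ Ω, u y ≤ u x₀)
    (y : EuclideanSpace ℝ (Fin n)) (hy : y ∈ Ω) : u y = u x₀ := by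
  -- globalise the coefficients off `Ω`
  obtain ⟨aG, haGm, haGs, haGe, haGb, haGΩ⟩ := exists_global_coeff hΩ.measurableSet hlam hmeas hsymm hell hbd
  have hweakG : ∀ η : EuclideanSpace ℝ (Fin n) → ℝ, ContDiff ℝ 1 η → HasCompactSupport η → tsupport η ⊆ Ω →
      ∫ y, ∑ i, ∑ j, aG y i j * fderiv ℝ u y (EuclideanSpace.single i 1) *
        fderiv ℝ η y (EuclideanSpace.single j 1) = 0 := by
    intro η hη hηc hηΩ
    rw [integrand_congr_coeff haGΩ u η hηΩ]
    exact hweak η hη hηc hηΩ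
  -- the tube and the lifted data
  have hΩt : IsOpen (proj n ⁻¹' Ω) := hΩ.preimage (proj n).continuous
  have hΩtc : IsPreconnected (proj n ⁻¹' Ω) := isPreconnected_preimage_proj hΩc
  have hut : ContDiffOn ℝ 1 (fun z => u (proj n z)) (proj n ⁻¹' Ω) :=
    hu.comp (proj n).contDiff.contDiffOn (fun z hz => hz)
  have hx₀t : emb n x₀ ∈ proj n ⁻¹' Ω := by simpa using hx₀
  have hyt : emb n y ∈ proj n ⁻¹' Ω := by simpa using hy
  have h := hP (proj n ⁻¹' Ω) hΩt hΩtc (liftCoeff aG) (min lam 1) (max (max Λ lam) 1) (lt_min hlam one_pos)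
    (measurable_liftCoeff haGm) (fun z _ => isSymm_liftCoeff haGs z) (fun z _ ξ => liftCoeff_elliptic haGe z ξ)
    (fun z _ I J => abs_liftCoeff_le haGb z I J) (fun z => u (proj n z)) hut
    (fun η hη hηc hηΩ => lift_weak_local hΩ haGm haGb hu hweakG η hη hηc hηΩ)
    (emb n x₀) hx₀t (fun z hz => by simpa using hmax (proj n z) hz) (emb n y) hyt
  simpa using h

end Summit.NavierStokesRegularity.NavierStokesRegularity.Theorems.PoloidalWindowDoorPoloidalWindowRigidityDivFormStrongMaximumPrincipleDescent

end
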